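import Summits.Schanuel.Schanuel.Theorems.RootDecomp1KSectorSubspace03

/-!
# RootDecomp1KSectorSubspace — lens 1, generation 70, NODE 30 «THE (4,2)-SECTOR BOX WITH SIMPLE EDGE ROOTS IS SUBSPACE» (×0-AS-RECORD, CONDITIONAL LANE — PRICE L3112, RULING L3115 (4); CLAIM L3110, NODE L3125, VERDICT L3131): for the (4,2)-sector box `boxP q` = (Y⁴ + δY³ + ζ₂Y² + ζ₁Y + ζ₀) + x·(αY² + βY + ε) + γ·x² with γ ODD and the edge quartic W⁴ + αW² + γ SEPARABLE, WINDOW LEVEL-FINITENESS and hence `LevelFinite` / `ThinFibreAt m₀` for every m₀ MODULO the route's existing binder `PadicSubspace` (hypothesis `hS`, never an axiom): `window_levels_finite`, `levelFinite_box_of_padicSubspace`, `thinFibreAt_box_of_padicSubspace`; node 11's second-order Subspace lever (tree `Lform` / `Mform` / `nearest_root` / `isAlgebraic_corr` BY NAME) transplanted to the (∞,∞) sector and closed by `transcendental_liouvilleNumber`; (H7) the GENERIC member (separable Δ_x) is node 23's — `thinFibreAt_box_of_separable_pDisc` hypothesis-free, `domHyper_box_iff`, `thinFibreAt_box_dichotomy`;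 consistency probe ρ1 (`thinFibreAt_rho1_of_padicSubspace`, unconditional by node 28); specimen M30 = (Y⁴ − Y³ − 6Y² + 2Y + 15) + x·(4Y² + Y − 27) + 11x² (singular at (1,1), ¬DomHyper, not split in the given coordinates, split after translation): `thinFibreAt_m30_of_padicSubspace` — continuation (RootDecomp1KSectorSubspace04): # §7  Consistency probe: the stratum-ρ1 member of record `Y⁴ + x·Y − 17·x²` (decided UNCONDITIONALLY by node 2 · # §8  THE SPECIMEN `M30` — a SINGULAR simple-edge member of the box outside every landed engine's class predic · # §9  (H7) THE GENERIC MEMBER IS NODE 23's: separable `Δ_x` ⇒ decided HYPOTHESIS-FREE by the tree's `thinFibre — 37 declarations `level_second_order` … `domHyper_box_iff`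

(lens-1 g70 NODE 30 «THE (4,2)-SECTOR BOX WITH SIMPLE EDGE ROOTS IS SUBSPACE» L3125: HOME kernel K = HOME/decomp-schanuel-lens-1/g70/lean/SectorSubspace.lean sha256 30de2f8e…, 1334 l, 87 decls (78 theorems + 8 defs + 1 structure `SectorBox`), ONE namespace `Summit.Schanuel.Schanuel.Theorems.RootDecomp1KSectorSubspace`, imports the tree port …RootDecomp1KExhibitDescent03 ONLY (node 29's record port; `PadicSubspace` / `Lform` / `Mform` / `nearest_root` / `isAlgebraic_corr` (SubspaceBranch), `rho1` (SectorTheorem), `pDisc` / `DomHyper` / `thinFibreAt_dom2` (HyperellipticSiegel), `thinFibreAt_of_levelFinite`, `tendsto_partialSum_two` BY TREE NAME); no private / instance / set_option / notation / sorry / new axiom; the binder `PadicSubspace` appears ONLY as the hypothesis `hS` of the `…_of_padicSubspace` heads; lens farm rc 0 · 0 errors · 0 sorries · 99 dupNamespace, `--axioms` standard on 13 heads, Probe g70/out/Probe.lean e9bf9f63… rc 0 (rfl pins @PadicSubspace = tree, @rho1 = tree, @pDisc / @DomHyper / @LevelFinite = tree), CONTROL ProbeCtrl ec7805c4… rc 1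 as designed, memo g70/NODE-g70.md 51b8502c…, SHA256SUMS 23/23; CLAIM L3110 (ASK-FIRST; conditional class theorem, no new binder, no exhibit); crit g12 PRICE 30 L3112: ×0-AS-RECORD, PORT WELCOME (conditional lane, like W4Dossier01 — K-R56 (ii)/(iii), the W4 precedent RULING L2988, K-R58 (iii): the binder PROVED is the one payable head), CHECKLIST K-g70 (H1)–(H6) + (S), W-30-1; writer g36 NOTE 4 L3113 (arithmetic pre-check 11/11 on 122 472 cleared quartics); census INSTRUMENT NOTE 48 L3114 (CE-25-1: the residue exhibits of record were DomHyper) and crit RULING L3115 ((3) ERRATUM E7 FIXED; (4) PRICE 30 REFINED: the box ∩ {{Δ_x separable}} is ALREADY DECIDED UNCONDITIONALLY by node 23's `thinFibreAt_dom2`, node 30's proper conditional reach = the SINGULAR members (α)/(β), CHECKLIST += (H7)); writer NOTE 5 L3123 (exhaustive box census 15 309: separable 14 498 / inseparable 811); census LIVENESS-v43 key box30 (rows 63 rho1 / 70 ρ1′ / 73 specimen); crit g13 VERDICT 30 L3131: «×0-AS-RECORD — BOOKED as priced (PRICE L3112, RULING L3115 (4)); CHECKLIST K-g70 (H1)–(H7)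 + (S) MET; NO objection to any kernel statement; three errata-lite in PROSE only (e30-2 lens, e30-3 writer, CE-25-2 census), all on the abscissa convention — zero kernel and zero record consequence; decl census 90 = 81 theorems + 8 defs + 1 structure (the three @[simp] lemmas svec_zero/one/two counted); --axioms on 33 heads standard, PadicSubspace ONLY as the explicit binder hS; RECORD AT VERDICT 30: Dom(PadicSubspace) map entry := {node 11 SepTopAt classes, W4, node-30 box ∖ DomHyper}, the DomHyper part printed in the UNCONDITIONAL lane as node 23 (H7); open territory / exhibits VACANT / ledger / tally UNCHANGED; PORT GO (conditional lane, W4Dossier01 precedent; every …_of_padicSubspace head keeps (hS : PadicSubspace) explicit; statements byte-verbatim to K; e30-2 docstring clause at the census choice — carried VERBATIM here, e30-2 standing in the errata list)». PORT-SIDE MODIFIER (bounce p850098, dedup.landed): K l.607 abs_num_eq ≡ tree RootDecomp1EPointTransfer.abs_num_eq ⇒ PRIVATE in part 02 + a private copy in part 03 (one use each), statements / proofs = K. Port by census-1 gen 25 as `RootDecomp1KSectorSubspace01–05` (files ≤ 400 lines; `--supports stmt-Schanuel-33364`, the item stays OPEN; ×0 record port in the CONDITIONAL lane — every `…_of_padicSubspace`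 head carries the hypothesis `hS : PadicSubspace` explicitly (W4Dossier01 precedent); no credit anywhere; record effect at VERDICT 30 = the MAP entry Dom(PadicSubspace) ∪= node-30 box ∖ DomHyper, the DomHyper part in the unconditional lane (node 23)): 01 = K l.1–384 of the prepped source (opens # §0 / # §1) — 25 decls `norm_two_ss`, `norm_two_pow_ss`, `norm_intCast_le_one_ss`, …, `eventually_K₀_small_ss`; 02 = K l.385–691 of the prepped source (opens # §2 / # §3 / # §4 / # §5) — 16 decls `level_shape`, `level_padic`, `first_order`, …, `sector_arith`; 03 = K l.692–1012 of the prepped source (opens # §6) — 11 decls `bev_boxP_liouville_ne_zero`, `no_point_near`, `level_le_two_mul_pow`, …, `thinFibreAt_box_of_padicSubspace'`; 04 = K l.1013–1333 of the prepped source (opens # §7 / # §8 / # §9) — 37 decls `level_second_order`, `rho1Box`, `boxC_rho1Box`, …, `domHyper_box_iff`; 05 = K l.1334–1343 of the prepped source (inside # §9) — 1 decls `thinFibreAt_box_dichotomy`. 0 one-line docstrings synthesised for undocumented helper declarations (statements quoted); everything else = K VERBATIM (statements, names, proofs, K's module docstring kept in part 01 below this provenance block).)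
-/

noncomputable section

namespace Summit.Schanuel.Schanuel.Theorems.RootDecomp1KSectorSubspace

open Polynomial LiouvilleNumber
open scoped Nat
open Summit.Schanuel.Schanuel.Theorems.RootDecomp1KTwoBaseCell (psNumer partialSum_eq_psNumer_div coprime_psNumer)
open Summit.Schanuel.Schanuel.Theorems.RootDecomp1KRelLiouvilleCell (partialSum_two_strictMono)
open Summit.Schanuel.Schanuel.Theorems.RootDecomp1KDegreeLadder
open Summit.Schanuel.Schanuel.Theorems.RootDecomp1KXLinearCore
open Summit.Schanuel.Schanuel.Theorems.RootDecomp1KXLinear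
open Summit.Schanuel.Schanuel.Theorems.RootDecomp1KXLinearII
open Summit.Schanuel.Schanuel.Theorems.RootDecomp1KXTop
open Summit.Schanuel.Schanuel.Theorems.RootDecomp1KSubspaceBranch
open Summit.Schanuel.Schanuel.Theorems.RootDecomp1KDigitPincer (odd_psNumer_two)
open Summit.Schanuel.Schanuel.Theorems.RootDecomp1KSectorTheorem (rho1 tendsto_partialSum_two)
open Summit.Schanuel.Schanuel.Theorems.RootDecomp1KHyperellipticSiegel (pDisc DomHyper domHyper_xPolyP_iff thinFibreAt_dom2 levelFinite_dom2)
open Summit.Schanuel.Schanuel.Theorems.RootDecomp1KIntegrality (DomZero)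
open Summit.Schanuel.Schanuel.Theorems.RootDecomp1KLevelFinite (LevelSet LevelFinite thinFibreAt_of_levelFinite)
open Summit.Schanuel.Schanuel.Theorems.RootDecomp1KHeightGrading (BddLevelEmpty bddLevelEmpty_iff_levelFinite)

/-- **(§2, PACKAGED) THE SECOND-ORDER LEMMA OF THE SECTOR.**  For a box member with separable edge quartic there are
a finite set `T ⊂ ℂ₂` of SIMPLE roots of `f = W⁴ + αW² + γ` (tree `nearest_root`), a constant `K > 0` and a level
`N₁` such that on every level `N ≥ N₁` (`2m = N!`) every solution `a` of the reduced equation is `K·2^{−m}`-close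
(and `1`-close) to some `ξ ∈ T` and satisfies `‖(a − ξ) + 2^m·γ_ξ‖₂ ≤ K·2^{−(N!−(N−1)!)}` with the algebraic
correction `γ_ξ = g(ξ)/f′(ξ)` (`isAlgebraic_corr (subG q) (edgeF q)`).  Hypothesis-free. -/
theorem level_second_order (q : SectorBox) (hsep : ((edgeF q).map (Int.castRingHom ℚ)).Separable) :
    ∃ (T : Finset (PadicAlgCl 2)) (K : ℝ) (N₁ : ℕ), 0 < K ∧
      (∀ ξ ∈ T, aeval ξ (edgeF q) = 0 ∧ aeval ξ (derivative (edgeF q)) ≠ 0) ∧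
      ∀ N m : ℕ, N₁ ≤ N → 2 * m = N ! → ∀ a : ℤ, redLHS q N m a = 0 →
        ∃ ξ ∈ T, ‖(a : PadicAlgCl 2) - ξ‖ ≤ K * (1 / 2 : ℝ) ^ m ∧ ‖(a : PadicAlgCl 2) - ξ‖ ≤ 1 ∧
          ‖((a : PadicAlgCl 2) - ξ) + (2 : PadicAlgCl 2) ^ m * (aeval ξ (subG q) / aeval ξ (derivative (edgeF q)))‖ ≤
            K * (1 / 2 : ℝ) ^ ((N !) - (N - 1)!) := by
  classical
  obtain ⟨T, c₀, hc₀, -, hTroots, -, hnear⟩ :=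
    nearest_root (edgeF q) (by rw [natDegree_edgeF]; norm_num) hsep
  set K₀ : ℝ := max 1 c₀ with hK₀
  have hK₀1 : 1 ≤ K₀ := le_max_left _ _
  have hder : ∀ ξ ∈ T, aeval ξ (derivative (edgeF q)) ≠ 0 := fun ξ hξ =>
    aeval_derivative_ne_zero_of_sep (edgeF q) hsep (hTroots ξ hξ)
  have hK : ∀ ξ ∈ T, ∃ K : ℝ, 0 < K ∧ ∀ N m : ℕ, 2 ≤ N → 2 * m = N ! → ∀ a : ℤ, redLHS q N m a = 0 →
      ‖(a : PadicAlgCl 2) - ξ‖ ≤ K₀ * (1 / 2 : ℝ) ^ m → ‖(a : PadicAlgCl 2) - ξ‖ ≤ 1 →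
      ‖((a : PadicAlgCl 2) - ξ) + (2 : PadicAlgCl 2) ^ m * (aeval ξ (subG q) / aeval ξ (derivative (edgeF q)))‖ ≤
        K * (1 / 2 : ℝ) ^ ((N !) - (N - 1)!) :=
    fun ξ hξ => second_order q (hTroots ξ hξ) (hder ξ hξ) K₀ hK₀1
  choose! Kf hKpos hKf using hK
  set Kmax : ℝ := ∑ ξ ∈ T, Kf ξ with hKmax
  have hKle : ∀ ξ ∈ T, Kf ξ ≤ Kmax := fun ξ hξ =>
    Finset.single_le_sum (fun b hb => (hKpos b hb).le) hξ
  obtain ⟨N₅, hN₅⟩ := eventually_K₀_small_ss K₀ hK₀1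
  have hKpos' : 0 < max K₀ Kmax := lt_max_iff.mpr (Or.inl (by linarith))
  refine ⟨T, max K₀ Kmax, max 2 N₅, hKpos', fun ξ hξ => ⟨hTroots ξ hξ, hder ξ hξ⟩, fun N m hN hm a hred => ?_⟩
  obtain ⟨hN2, hNN₅⟩ := max_le_iff.mp hN
  have hf1 := first_order q hN2 hm hred
  obtain ⟨ξ, hξT, hξ⟩ := hnear (a : PadicAlgCl 2)
  have hδ : ‖(a : PadicAlgCl 2) - ξ‖ ≤ K₀ * (1 / 2 : ℝ) ^ m := by
    calc ‖(a : PadicAlgCl 2) - ξ‖ ≤ c₀ * ‖aeval (a : PadicAlgCl 2) (edgeF q)‖ := hξ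
      _ ≤ c₀ * (1 / 2 : ℝ) ^ m := by gcongr
      _ ≤ K₀ * (1 / 2 : ℝ) ^ m := by gcongr; exact le_max_right _ _
  have hδ1 : ‖(a : PadicAlgCl 2) - ξ‖ ≤ 1 := hδ.trans (hN₅ N m hNN₅ hm)
  have happrox := hKf ξ hξT N m hN2 hm a hred hδ hδ1
  refine ⟨ξ, hξT, hδ.trans ?_, hδ1, happrox.trans ?_⟩
  · exact mul_le_mul_of_nonneg_right (le_max_left _ _) (by positivity)
  · exact mul_le_mul_of_nonneg_right ((hKle ξ hξT).trans (le_max_right _ _)) (by positivity)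

/-! ### §7  Consistency probe: the stratum-ρ1 member of record `Y⁴ + x·Y − 17·x²` (decided UNCONDITIONALLY by node 28's descent, tree `RootDecomp1KResidueDescent.thinFibreAt_rho1`; here re-decided modulo `PadicSubspace` as a box member) -/

/-- the member of record ρ1 = `Y⁴ + x·Y − 17·x²` as a box member: `δ = ζ₂ = ζ₁ = ζ₀ = α = ε = 0`, `β = 1`,
`γ = −17`. -/
def rho1Box : SectorBox := ⟨0, 0, 0, 0, 0, 1, 0, -17⟩

/-- `: boxC rho1Box = rho1` (the tree's coefficient vector of ρ1, `RootDecomp1KSectorTheorem.rho1`). -/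
theorem boxC_rho1Box : boxC rho1Box = rho1 := by
  funext j
  simp only [boxC, rho1, rho1Box]
  split_ifs <;> simp

/-- `: boxP rho1Box = xPolyP 2 rho1`. -/
theorem boxP_rho1Box : boxP rho1Box = xPolyP 2 rho1 := by
  rw [boxP, boxC_rho1Box]

/-- the edge quartic of ρ1 is `W⁴ − 17`, separable over `ℚ`. -/
theorem edgeF_rho1Box_separable : ((edgeF rho1Box).map (Int.castRingHom ℚ)).Separable := by
  have h : (edgeF rho1Box).map (Int.castRingHom ℚ) = X ^ 4 - C (17 : ℚ) := by
    simp only [edgeF, rho1Box, Polynomial.map_add, Polynomial.map_mul, Polynomial.map_pow, map_X,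
      Polynomial.map_C]
    simp
    ring
  rw [h]
  exact separable_X_pow_sub_C (17 : ℚ) (by norm_num) (by norm_num)

/-- consistency probe: WINDOW LEVEL-FINITENESS of `Y⁴ + x·Y − 17·x²` modulo `PadicSubspace` (the member is decided
UNCONDITIONALLY by node 28: tree `no_level_rho1`, `levelFinite_rho1`, `thinFibreAt_rho1`). -/
theorem window_levels_finite_rho1 (hS : PadicSubspace) (C : ℝ) :
    ∃ N₀ : ℕ, ∀ N : ℕ, N₀ ≤ N → ∀ r : ℚ, |(r : ℝ)| ≤ C → bev (xPolyP 2 rho1) (partialSum 2 N) r ≠ 0 := by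
  rw [← boxP_rho1Box]
  exact window_levels_finite hS rho1Box ⟨-9, by norm_num [rho1Box]⟩ edgeF_rho1Box_separable C

/-- consistency probe: `ThinFibreAt m₀ (xPolyP 2 rho1)` for every `m₀` modulo `PadicSubspace` (UNCONDITIONAL in the
tree: `RootDecomp1KResidueDescent.thinFibreAt_rho1`, node 28; ρ1 is in the residue of the sector theorem at `m₀ ≤ 2`,
tree `residue_rho1`). -/
theorem thinFibreAt_rho1_of_padicSubspace (hS : PadicSubspace) (m₀ : ℕ) : ThinFibreAt m₀ (xPolyP 2 rho1) := by
  rw [← boxP_rho1Box]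
  exact thinFibreAt_box_of_padicSubspace hS rho1Box ⟨-9, by norm_num [rho1Box]⟩ edgeF_rho1Box_separable m₀

/-! ### §8  THE SPECIMEN `M30` — a SINGULAR simple-edge member of the box outside every landed engine's class predicate that is decidable by inspection here

`M30 = (Y⁴ − Y³ − 6Y² + 2Y + 15) + x·(4Y² + Y − 27) + 11·x²` (`δ = −1, ζ₂ = −6, ζ₁ = 2, ζ₀ = 15, α = 4, β = 1,
ε = −27, γ = 11`).  PROVED here: `γ` odd; edge quartic `W⁴ + 4W² + 11` SEPARABLE (explicit Bézout identity
`f·(28 − 8W²) + f′·(2W³ − 3W) = 308`); the `x`-discriminant `Δ_x = c₁² − 4γc₀ = −28Y⁴ + 52Y³ + 49Y² − 142Y + 69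
= (Y − 1)²·(−28Y² − 4Y + 69)` is INSEPARABLE, so node 23's class predicate FAILS (`¬ DomHyper`, via the tree's
`domHyper_xPolyP_iff`); `c₀` and `c₁` are COPRIME over `ℚ` (explicit: `64·c₀ = (16Y² − 20Y + 17)·c₁ − 429Y + 1419`), so
`M30` is NOT in split form `(Y − θ)·Q + γx²`; and — the theorem — `LevelFinite` / `ThinFibreAt m₀ ∀ m₀` MODULO
`PadicSubspace`.  BY HAND (memo §M30, census row requested): the curve is singular at `(x, Y) = (1, 1)` with
normalisation the conic `z² = −28Y² − 4Y + 69 ∋ (−1/2, 8)` (infinitely many rational points; real branch through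
`x = ℓ₂` near `Y ≈ −0.3`); the edge root `β` with `β² = −2 − √−7 ≡ 1 (mod 8)` lies in `ℚ₂`, is simple, `g(β) =
β(1 − β²) ≠ 0` and `γ_β = g(β)/f′(β) = δ/4 − (β_coef − 2δ)/(4√−7) ∉ ℚ` — stratum ρ1, `SectorCond 2 2` fails; not bi-pure,
not `quartC`/`splitC`/`sqTopC`-shaped (`γ = 11` is not a square, `c₀(0) = 15 ≠ 0`).  In the terms of RULING
L3115 (4) `M30` is of type (β): the `x`-translate by the rational singular abscissa `x₀ = 1` of a split-form member
(`bev_m30_translate`); whether node 29's split descent transports along `x ↦ x − 1` on the pinned levels is NOT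
claimed either way («descent-prone»). -/

/-- the specimen `M30 = (Y⁴ − Y³ − 6Y² + 2Y + 15) + x·(4Y² + Y − 27) + 11·x²`. -/
def m30Box : SectorBox := ⟨-1, -6, 2, 15, 4, 1, -27, 11⟩

/-- `: boxC m30Box 0 = Y⁴ − Y³ − 6Y² + 2Y + 15`. -/
theorem boxC_m30Box_zero :
    boxC m30Box 0 = X ^ 4 + C (-1) * X ^ 3 + C (-6) * X ^ 2 + C 2 * X + C 15 := by
  rw [boxC_zero]; rfl

/-- `: boxC m30Box 1 = 4Y² + Y − 27`. -/
theorem boxC_m30Box_one : boxC m30Box 1 = C 4 * X ^ 2 + C 1 * X + C (-27) := by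
  rw [boxC_one]; rfl

/-- `: boxC m30Box 2 = 11`. -/
theorem boxC_m30Box_two : boxC m30Box 2 = C 11 := by
  rw [boxC_two]; rfl

/-- `(x y : ℝ) : P_{M30}(x, y) = y⁴ − y³ − 6y² + 2y + 15 + x(4y² + y − 27) + 11x²`. -/
theorem bev_m30 (x y : ℝ) : bev (boxP m30Box) x y =
    y ^ 4 - y ^ 3 - 6 * y ^ 2 + 2 * y + 15 + x * (4 * y ^ 2 + y - 27) + 11 * x ^ 2 := by
  rw [bev_boxP]
  simp [m30Box]
  ring

/-- the (β)-reading of RULING L3115 (4): translating the rational singular point `(1, 1)` to the origin puts `M30` in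
SPLIT form — `P(x + 1, y + 1) = y²(y² + 3y + 1) + x·y·(4y + 9) + 11x²`; `M30` itself is NOT split (`c₀ ⊥ c₁`,
`isCoprime_m30_c0_c1`), and `x ↦ x + 1` does not preserve the pinned levels `x = s_N`. -/
theorem bev_m30_translate (x y : ℝ) : bev (boxP m30Box) (x + 1) (y + 1) =
    y ^ 2 * (y ^ 2 + 3 * y + 1) + x * y * (4 * y + 9) + 11 * x ^ 2 := by
  rw [bev_m30]; ring

/-- `γ = 11` is odd. -/
theorem m30Box_gamma_odd : Odd m30Box.γ := ⟨5, by norm_num [m30Box]⟩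

/-- `α² ≠ 4γ` for `M30` (`16 ≠ 44`). -/
theorem m30Box_alpha_sq_ne : m30Box.α ^ 2 ≠ 4 * m30Box.γ := by norm_num [m30Box]

/-- the edge quartic of `M30` over `ℚ` is `W⁴ + 4W² + 11`. -/
theorem edgeF_m30Box_map : (edgeF m30Box).map (Int.castRingHom ℚ) = X ^ 4 + 4 * X ^ 2 + 11 := by
  simp only [edgeF, m30Box, Polynomial.map_add, Polynomial.map_mul, Polynomial.map_pow, map_X, Polynomial.map_C]
  simp [Polynomial.C_ofNat]

/-- the edge quartic `W⁴ + 4W² + 11` of `M30` is SEPARABLE: `f·(28 − 8W²) + f′·(2W³ − 3W) = 308`. -/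
theorem edgeF_m30Box_separable : ((edgeF m30Box).map (Int.castRingHom ℚ)).Separable := by
  rw [edgeF_m30Box_map, Polynomial.Separable]
  have hd : derivative (X ^ 4 + 4 * X ^ 2 + 11 : ℚ[X]) = 4 * X ^ 3 + 8 * X := by
    simp only [derivative_add, derivative_mul, derivative_X_pow, derivative_ofNat, Nat.cast_ofNat, map_ofNat]
    norm_num
    ring
  rw [hd]
  have h308 : (C (1 / 308 : ℚ)) * (308 : ℚ[X]) = 1 := by
    rw [← map_ofNat C 308, ← map_mul]
    norm_num
  exact ⟨C (1 / 308 : ℚ) * (28 - 8 * X ^ 2), C (1 / 308 : ℚ) * (2 * X ^ 3 - 3 * X), by linear_combination h308⟩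

/-- the `x`-discriminant of `M30` over `ℚ`: `Δ_x = c₁² − 4c₀c₂ = (Y − 1)²·(−28Y² − 4Y + 69)` (tree `pDisc`, node 23). -/
theorem pDisc_m30Box_map : (pDisc (boxC m30Box)).map (Int.castRingHom ℚ) =
    (X - 1) * (X - 1) * (-(28 * X ^ 2) - 4 * X + 69) := by
  rw [pDisc, boxC_m30Box_zero, boxC_m30Box_one, boxC_m30Box_two]
  simp only [Polynomial.map_sub, Polynomial.map_mul, Polynomial.map_pow, Polynomial.map_add, map_X,
    Polynomial.map_C, Polynomial.map_ofNat]
  simp [Polynomial.C_ofNat]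
  ring

/-- **the `x`-discriminant of `M30` is INSEPARABLE** (double root `Y = 1`): node 23's hypothesis fails. -/
theorem pDisc_m30Box_not_separable : ¬ ((pDisc (boxC m30Box)).map (Int.castRingHom ℚ)).Separable := by
  intro hsep
  have hsq := hsep.squarefree
  rw [pDisc_m30Box_map] at hsq
  have hu : IsUnit (X - 1 : ℚ[X]) := hsq (X - 1) ⟨-(28 * X ^ 2) - 4 * X + 69, by ring⟩
  exact Polynomial.not_isUnit_X_sub_C (1 : ℚ) (by simpa using hu)

/-- **`M30` is NOT in node 23's class**: `¬ DomHyper (boxP m30Box)` (tree `domHyper_xPolyP_iff`: on a genuine top,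
`DomHyper ↔ DomZero ∧ Δ_x separable ∧ 3 ≤ deg Δ_x`). -/
theorem not_domHyper_m30 : ¬ DomHyper (boxP m30Box) := by
  intro h
  have h2 : boxC m30Box 2 ≠ 0 := by
    rw [boxC_m30Box_two]
    exact C_ne_zero.mpr (by norm_num)
  exact pDisc_m30Box_not_separable ((domHyper_xPolyP_iff _ h2).mp h).2.1

/-- **`c₀` and `c₁` of `M30` are COPRIME over `ℚ`** (no common root: `64·c₀ = (16Y² − 20Y + 17)·c₁ − 429Y + 1419` and
`c₁(1419/429) ≠ 0`) — `M30` is not in split form `(Y − θ)·Q(x, Y) + γ·x²`. -/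
theorem isCoprime_m30_c0_c1 :
    IsCoprime ((boxC m30Box 0).map (Int.castRingHom ℚ)) ((boxC m30Box 1).map (Int.castRingHom ℚ)) := by
  have h0 : (boxC m30Box 0).map (Int.castRingHom ℚ) = X ^ 4 - X ^ 3 - 6 * X ^ 2 + 2 * X + 15 := by
    rw [boxC_m30Box_zero]
    simp only [Polynomial.map_mul, Polynomial.map_pow, Polynomial.map_add, map_X, Polynomial.map_C]
    simp [Polynomial.C_ofNat]
    ring
  have h1 : (boxC m30Box 1).map (Int.castRingHom ℚ) = 4 * X ^ 2 + X - 27 := by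
    rw [boxC_m30Box_one]
    simp only [Polynomial.map_mul, Polynomial.map_pow, Polynomial.map_add, map_X, Polynomial.map_C]
    simp [Polynomial.C_ofNat]
    ring
  rw [h0, h1]
  refine (Polynomial.isCoprime_iff_aeval_ne_zero_of_isAlgClosed ℚ ℂ _ _).2 fun z => ?_
  by_contra h
  push Not at h
  obtain ⟨hz0, hz1⟩ := h
  simp only [map_add, map_sub, map_mul, map_pow, aeval_X, map_ofNat] at hz0 hz1
  have hz : (429 : ℂ) * z = 1419 := by linear_combination (16 * z ^ 2 - 20 * z + 17) * hz1 - 64 * hz0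
  have hz' : z = 1419 / 429 := by rw [← hz]; ring
  rw [hz'] at hz1
  norm_num at hz1

/-- **`M30` IS DECIDED MODULO `PadicSubspace`**: window level-finiteness. -/
theorem window_levels_finite_m30 (hS : PadicSubspace) (C : ℝ) :
    ∃ N₀ : ℕ, ∀ N : ℕ, N₀ ≤ N → ∀ r : ℚ, |(r : ℝ)| ≤ C → bev (boxP m30Box) (partialSum 2 N) r ≠ 0 :=
  window_levels_finite hS m30Box m30Box_gamma_odd edgeF_m30Box_separable C

/-- **`M30` IS DECIDED MODULO `PadicSubspace`**: `LevelFinite (boxP m30Box)`. -/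
theorem levelFinite_m30_of_padicSubspace (hS : PadicSubspace) : LevelFinite (boxP m30Box) :=
  levelFinite_box_of_padicSubspace hS m30Box m30Box_gamma_odd edgeF_m30Box_separable

/-- **`M30` IS DECIDED MODULO `PadicSubspace`**: `ThinFibreAt m₀ (boxP m30Box)` for every `m₀`. -/
theorem thinFibreAt_m30_of_padicSubspace (hS : PadicSubspace) (m₀ : ℕ) : ThinFibreAt m₀ (boxP m30Box) :=
  thinFibreAt_box_of_padicSubspace hS m30Box m30Box_gamma_odd edgeF_m30Box_separable m₀

/-- `BddLevelEmpty (boxP m30Box)` modulo `PadicSubspace`. -/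
theorem bddLevelEmpty_m30_of_padicSubspace (hS : PadicSubspace) : BddLevelEmpty (boxP m30Box) :=
  bddLevelEmpty_box_of_padicSubspace hS m30Box m30Box_gamma_odd edgeF_m30Box_separable

/-! ### §9  (H7) THE GENERIC MEMBER IS NODE 23's: separable `Δ_x` ⇒ decided HYPOTHESIS-FREE by the tree's `thinFibreAt_dom2`

In the box `Δ_x = pDisc (boxC q) = c₁² − 4γc₀` has `Y⁴`-coefficient `α² − 4γ`, which is non-zero as soon as the edge
quartic is separable (`α² = 4γ` makes `f = (W² + α/2)²`), so `deg Δ_x = 4 ≥ 3`; `DomZero 2` is automatic (`c₀` monic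
quartic, `deg c₁ ≤ 2`, `deg c₂ = 0`).  Hence a member with SEPARABLE `Δ_x` is decided UNCONDITIONALLY by node 23
(`RootDecomp1KHyperellipticSiegel.thinFibreAt_dom2` / `levelFinite_dom2`, BY NAME) — the conditional theorem
`thinFibreAt_box_of_padicSubspace` is NEW only on the SINGULAR members (`Δ_x` inseparable), such as `M30` (§8). -/

/-- `: deg c₀ = 4`. -/
theorem natDegree_boxC_zero (q : SectorBox) : (boxC q 0).natDegree = 4 := by
  rw [boxC_zero]; compute_degree!

/-- `: deg c₁ ≤ 2`. -/
theorem natDegree_boxC_one_le (q : SectorBox) : (boxC q 1).natDegree ≤ 2 := by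
  rw [boxC_one]; compute_degree

/-- `: deg c₂ = 0`. -/
theorem natDegree_boxC_two (q : SectorBox) : (boxC q 2).natDegree = 0 := by
  rw [boxC_two]; exact natDegree_C _

/-- the box is `DomZero 2` (tree `RootDecomp1KIntegrality.DomZero`). -/
theorem domZero_boxC (q : SectorBox) : DomZero 2 (boxC q) := by
  intro j hj1 hj2
  rw [natDegree_boxC_zero]
  interval_cases j
  · exact lt_of_le_of_lt (natDegree_boxC_one_le q) (by norm_num)
  · rw [natDegree_boxC_two]; norm_num

/-- the `x`-discriminant of the box, coefficient by coefficient. -/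
theorem pDisc_boxC (q : SectorBox) : pDisc (boxC q) =
    C (q.α ^ 2 - 4 * q.γ) * X ^ 4 + C (2 * q.α * q.β - 4 * q.γ * q.δ) * X ^ 3 +
      C (q.β ^ 2 + 2 * q.α * q.ε - 4 * q.γ * q.ζ₂) * X ^ 2 + C (2 * q.β * q.ε - 4 * q.γ * q.ζ₁) * X +
      C (q.ε ^ 2 - 4 * q.γ * q.ζ₀) := by
  rw [pDisc, boxC_zero, boxC_one, boxC_two]
  simp only [map_sub, map_add, map_mul, map_pow, map_ofNat]
  ring

/-- `: (Δ_x).coeff 4 = α² − 4γ`. -/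
theorem coeff_pDisc_boxC_four (q : SectorBox) : (pDisc (boxC q)).coeff 4 = q.α ^ 2 - 4 * q.γ := by
  rw [pDisc_boxC]
  simp only [coeff_add, coeff_C_mul, coeff_X_pow, coeff_X, coeff_C]
  norm_num

/-- `α² ≠ 4γ ⇒ 4 ≤ deg Δ_x`. -/
theorem four_le_natDegree_pDisc_boxC (q : SectorBox) (hα : q.α ^ 2 ≠ 4 * q.γ) :
    4 ≤ (pDisc (boxC q)).natDegree :=
  le_natDegree_of_ne_zero (by rw [coeff_pDisc_boxC_four]; exact sub_ne_zero.mpr hα)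

/-- a separable edge quartic has `α² ≠ 4γ` (`α² = 4γ` makes `f = (W² + α/2)²`). -/
theorem alpha_sq_ne_of_edgeF_separable (q : SectorBox) (hsep : ((edgeF q).map (Int.castRingHom ℚ)).Separable) :
    q.α ^ 2 ≠ 4 * q.γ := by
  intro h
  have hsq := hsep.squarefree
  have hf : (edgeF q).map (Int.castRingHom ℚ) = X ^ 4 + C (q.α : ℚ) * X ^ 2 + C (q.γ : ℚ) := by
    simp only [edgeF, Polynomial.map_add, Polynomial.map_mul, Polynomial.map_pow, map_X, Polynomial.map_C]
    simp only [eq_intCast]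
  have hγ : (q.γ : ℚ) = (q.α : ℚ) / 2 * ((q.α : ℚ) / 2) := by
    have h' : ((q.α ^ 2 : ℤ) : ℚ) = ((4 * q.γ : ℤ) : ℚ) := by rw [h]
    push_cast at h'
    linarith
  have hsq' : X ^ 4 + C (q.α : ℚ) * X ^ 2 + C (q.γ : ℚ) =
      (X ^ 2 + C ((q.α : ℚ) / 2)) * (X ^ 2 + C ((q.α : ℚ) / 2)) := by
    have e1 : C (q.α : ℚ) = C ((q.α : ℚ) / 2) * 2 := by
      rw [← map_ofNat C 2, ← map_mul]; congr 1; ring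
    have e2 : C (q.γ : ℚ) = C ((q.α : ℚ) / 2) * C ((q.α : ℚ) / 2) := by rw [← map_mul, hγ]
    rw [e1, e2]; ring
  rw [hf, hsq'] at hsq
  have hu : IsUnit (X ^ 2 + C ((q.α : ℚ) / 2)) := hsq _ dvd_rfl
  have h0 := Polynomial.natDegree_eq_zero_of_isUnit hu
  have h2 : (X ^ 2 + C ((q.α : ℚ) / 2)).natDegree = 2 := by compute_degree!
  omega

/-- **(H7) separable `Δ_x` (and `α² ≠ 4γ`) ⇒ `ThinFibreAt m₀ (boxP q)` for every `m₀`, HYPOTHESIS-FREE** — node 23's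
`thinFibreAt_dom2` BY NAME; no `PadicSubspace`. -/
theorem thinFibreAt_box_of_separable_pDisc (q : SectorBox) (hα : q.α ^ 2 ≠ 4 * q.γ)
    (hsep : ((pDisc (boxC q)).map (Int.castRingHom ℚ)).Separable) (m₀ : ℕ) : ThinFibreAt m₀ (boxP q) :=
  thinFibreAt_dom2 (boxC q) (domZero_boxC q) hsep
    (le_trans (by norm_num) (four_le_natDegree_pDisc_boxC q hα)) m₀

/-- (H7) separable `Δ_x` (and `α² ≠ 4γ`) ⇒ `LevelFinite (boxP q)`, HYPOTHESIS-FREE (node 23's `levelFinite_dom2`). -/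
theorem levelFinite_box_of_separable_pDisc (q : SectorBox) (hα : q.α ^ 2 ≠ 4 * q.γ)
    (hsep : ((pDisc (boxC q)).map (Int.castRingHom ℚ)).Separable) : LevelFinite (boxP q) :=
  levelFinite_dom2 (boxC q) (domZero_boxC q) hsep (le_trans (by norm_num) (four_le_natDegree_pDisc_boxC q hα))

/-- (H7) on the node's own hypothesis (separable EDGE quartic): separable `Δ_x` ⇒ decided HYPOTHESIS-FREE. -/
theorem thinFibreAt_box_of_separable_pDisc' (q : SectorBox) (hedge : ((edgeF q).map (Int.castRingHom ℚ)).Separable)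
    (hsep : ((pDisc (boxC q)).map (Int.castRingHom ℚ)).Separable) (m₀ : ℕ) : ThinFibreAt m₀ (boxP q) :=
  thinFibreAt_box_of_separable_pDisc q (alpha_sq_ne_of_edgeF_separable q hedge) hsep m₀

/-- (H7) the box member is in node 23's class `DomHyper` IFF its `Δ_x` is separable (given `γ ≠ 0`, `α² ≠ 4γ`). -/
theorem domHyper_box_iff (q : SectorBox) (hγ : q.γ ≠ 0) (hα : q.α ^ 2 ≠ 4 * q.γ) :
    DomHyper (boxP q) ↔ ((pDisc (boxC q)).map (Int.castRingHom ℚ)).Separable := by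
  have h2 : boxC q 2 ≠ 0 := by rw [boxC_two]; exact C_ne_zero.mpr hγ
  rw [boxP, domHyper_xPolyP_iff _ h2]
  constructor
  · exact fun h => h.2.1
  · exact fun h => ⟨domZero_boxC q, h, le_trans (by norm_num) (four_le_natDegree_pDisc_boxC q hα)⟩

end Summit.Schanuel.Schanuel.Theorems.RootDecomp1KSectorSubspace
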